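import Summits.QuantumFields.YangMills.Theorems.FluctuationComparisonRegPrIntLS2BetaPosCollarAtIrreducible
import Summits.QuantumFields.YangMills.Theorems.FluctuationComparisonRegPrIntLS2BetaNearStabiliserRigidity
import Summits.QuantumFields.YangMills.Theorems.FluctuationComparisonRegPrIntLS2BetaCriticalOrbitUnique
import HarnessLib

/-!
# S2β · seam (b) — (T7-red, I) NEAR THE FULL ORBIT ⟹ NEAR THE RESIDUAL ORBIT ON A FIBRE OVER **ANY DATUM WHOSE SYMMETRIES LIFT TO THE BASE POINT**

Cell `ym3-torus` (YM ladder rung R3 = continuum `SU(2)` Yang–Mills on the three-torus at fixed lattice data — a RUNG: NOT d = 4, NOT infinite volume,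
NOT a mass gap, NOT Clay).  Width seat `ym3-torus-px8` (gen 19), the (T)-chain of LINE g18-1 S2β, seam (b).  Crux `stmt-QuantumFields-20520`
(`…Theses.UnitScaleTilt.FluctuationComparisonRegPrIntL`); `--kind proof --supports stmt-QuantumFields-20520 --as helper`, count-neutral, DEFINITION-FREE
(0 `def`, 0 `instance`, 0 `notation`, 0 `sorry`, default heartbeats).

WHY.  ✓px21 (T7b) `…S2BetaPosCollarAtIrreducible` §4 turns «`U` near the FULL gauge orbit of `U₀`» into «`U` near the RESIDUAL orbit of `U₀`» on a fibre over an IRREDUCIBLE datum,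
via NEAR-SYMMETRY rigidity («`(u⁻¹)↓` is sitewise near ONE scalar»).  At a REDUCIBLE datum `(u⁻¹)↓` is only near SOME EXACT SYMMETRY `k₀` of `V` — ✓`…S2BetaNearStabiliserRigidity.exists_near_stabiliser`
(NEAR-STABILISER RIGIDITY, zero hypotheses, this seat) — and the argument goes through as soon as `k₀` LIFTS to a symmetry of the base point, `∃ k̃, k̃ • U₀ = U₀ ∧ k̃↓ = k₀`: EXACTLY
✓px17 pen 4's lifting hypothesis (`…S2BetaCriticalOrbitUnique.sameOrbit_of_symmetriesLift_five` :212–213, read at the point `U₀`, α-renamed `n ↦ J`; the SAME token the ISOL∘ side of the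
seam displays).  Replacing `u` by `u₁ := u·k̃` (same action on `U₀`) makes `(u₁⁻¹)↓ = k₀⁻¹·(u⁻¹)↓` sitewise near `1`, and (T7a) §3's residual correction applies verbatim:
* §1 ★★ `exists_residual_near_of_near_orbit_of_lift` — (T7b) §4 with `HR` := near-STABILISER rigidity (the conclusion shape of ✓`exists_near_stabiliser`) and `hlift`; SAME constant
  `(1 + 2·√#bonds_K·K_V·√#bonds_J·Kπ)`; letters (Lπ)_loc (J5 sup-norm shape) and the tube radius as in (T7b).
* §2 `symmetriesLift_of_centralStab` — at a CENTRAL-STABILISER datum (pen 4's token `∀ s, s • V = V → s = 1 ∨ s = −1`, cited) `hlift` holds at EVERY `U₀` (lift `±1` to the constant `±1`):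
  the irreducible stratum is the special case.  Other suppliers of `hlift`: ⧗px12 (B) `…S2BetaAbelianSymmetricCriticality` (case-A abelian data ⟸ EX^{ab}), the flat∕central rigidity files.
CONSUMER (this seat's next file): (T7-red, II) `…S2BetaPosCollarOfStabiliserLift` = (T7b) §5's three theorems with IRR(V) ↦ `hlift`.

HONEST: kinematics ∕ composition over landed theorems; nothing of Bałaban's analysis; `hlift` at reducible data, (Lπ)_loc, ISOL∘(δ), TUBE-REG∘ (datum-free δ, K-uniform μ), GAP♯∘, GAP♭, EXW∘,
S2β, crux 20520 NOT proved; no summit statement is proved by a helper; finite-volume ∕ conditional; rung R3 = SU(2) YM₃ on T³ — NOT d = 4, NOT infinite volume, NOT a mass gap, NOT Clay;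
the Yang–Mills mass gap is NOT proved.  Sorry-free, axioms standard.

References: T. Bałaban, CMP **102** (1985) 277–309 [Balaban1985Variational] ((4)–(6) p.278, Thm 1 (8)–(10) p.279, Prop. 7 p.299); CMP **98** (1985) 17–51 [Balaban1985Averaging]
((8), (11)–(13) p.19, Prop. 5 (156)–(157) p.42); CMP **99** (1985) 75–102 [Balaban1985RegularSpaces] (Thm 2 p.83).
-/

set_option autoImplicit false

noncomputable section

namespace Summit.QuantumFields.YangMills.Theorems.FluctuationComparisonRegPrIntLS2BetaResidualNearOfStabiliserLift



open Set Filter Topology Function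
open scoped Matrix.Norms.L2Operator
open Literature.MathematicalPhysics.QuantumFieldTheory.Balaban1983to89
open Literature.MathematicalPhysics.QuantumFieldTheory.Balaban1983to89.T3ContinuumYM3Torus
open Literature.MathematicalPhysics.QuantumFieldTheory.Balaban1983to89.T3UnitLawDensityEML (ℰp)
open Literature.MathematicalPhysics.QuantumFieldTheory.Balaban1983to89.T3UnitScaleTilt
open Literature.MathematicalPhysics.QuantumFieldTheory.Balaban1983to89.T3TiltDescent
open Literature.MathematicalPhysics.QuantumFieldTheory.Balaban1983to89.T3ConstrainedMinimiser (fibre)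
open Literature.MathematicalPhysics.QuantumFieldTheory.Balaban1983to89.T3PrintedRegularMinimiser
open Literature.MathematicalPhysics.QuantumFieldTheory.Balaban1983to89.T3PrintedRegularOrbits (descTransf descendTo_gaugeAct liftTransfTo descTransf_liftTransfTo)
open Literature.MathematicalPhysics.QuantumFieldTheory.Balaban1983to89.T3Thm1CarrierNative (IsCritR2)
open Literature.MathematicalPhysics.QuantumFieldTheory.Balaban1983to89.T4Continuum
open scoped Literature.MathematicalPhysics.QuantumFieldTheory.Balaban1983to89.T3OrbitAverage
open Summit.QuantumFields.YangMills.Theorems.FluctuationComparisonRegPrIntLS2BetaResidualGauge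
open Summit.QuantumFields.YangMills.Theorems.FluctuationComparisonRegPrIntLS2BetaPosCollarOfGrowthRow (iInf_orbitDistSq_gaugeAct_left iInf_orbitDistSq_le_sum_one)
open Summit.QuantumFields.YangMills.Theorems.FluctuationComparisonRegPrIntLS2BetaPosCollarCoverOfTubeChart (mem_fibre_of_mem_closure_of_continuousAt)
open Summit.QuantumFields.YangMills.Theorems.FluctuationComparisonRegPrIntLS2BetaPosCollarOfLocalGrowth
open Summit.QuantumFields.YangMills.Theorems.FluctuationComparisonRegPrIntLS2BetaOrbitDistComparison (sum_dist1_sq_gaugeAct sum_dist1_sq_comm sqrt_sum_dist1_sq_triangle)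
open Summit.QuantumFields.YangMills.Theorems.FluctuationComparisonRegPrIntLS2BetaOrbitGrowthOfRegular (orbitGrowth_of_isCritR2_five)
open Summit.QuantumFields.YangMills.Theorems.Prop7CritEL (isOpen_regPr)
open Summit.QuantumFields.YangMills.Theorems.FluctuationComparisonRegPrIntLS2BetaSignedCombLipschitz (dist1_mul_inv_eq_norm_sub)
open Summit.QuantumFields.YangMills.Theorems.FluctuationComparisonRegPrIntLS2BetaNearSymmetryRigidity
open Summit.QuantumFields.YangMills.Theorems.FluctuationComparisonRegPrIntLS2BetaNearStabiliserRigidity (exists_near_stabiliser)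

open Summit.QuantumFields.YangMills.Theorems.BrascampLiebVacuumSC.DimensionGapSU2 (neg_one_mem)
/-! ## §1 Near the FULL orbit ⟹ near the RESIDUAL orbit, on a fibre over ANY datum whose symmetries lift to the base point -/

section Lift

variable (F : T3Family) {J K : ℕ} (hJK : J ≤ K)

/-- Restriction up the centres of a product of two inverses: `((a⁻¹·b⁻¹))^{(i)} = (a^{(i)})⁻¹·(b^{(i)})⁻¹`. [cite: Balaban1985Averaging, (11)-(13) p.19] -/
theorem transfUp_inv_mul_inv (a b : GaugeTransf (F.P K) 0 (Matrix.specialUnitaryGroup (Fin 2) ℂ)) :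
    ∀ (i : ℕ) (y : Site (F.P K) i), transfUp (fun x => (a x)⁻¹ * (b x)⁻¹) i y = (transfUp a i y)⁻¹ * (transfUp b i y)⁻¹
  | 0, _ => rfl
  | i + 1, _ => transfUp_inv_mul_inv a b i _

/-- Restriction up the centres of an inverse: `(a⁻¹)^{(i)} = (a^{(i)})⁻¹`. [cite: Balaban1985Averaging, (11)-(13) p.19] -/
theorem transfUp_inv' (a : GaugeTransf (F.P K) 0 (Matrix.specialUnitaryGroup (Fin 2) ℂ)) :
    ∀ (i : ℕ) (y : Site (F.P K) i), transfUp (fun x => (a x)⁻¹) i y = (transfUp a i y)⁻¹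
  | 0, _ => rfl
  | i + 1, _ => transfUp_inv' a i _

/-- ★★ **ON A FIBRE OVER ANY DATUM WHOSE SYMMETRIES LIFT TO `U₀`, «NEAR THE FULL GAUGE ORBIT OF `U₀`» IMPLIES «NEAR ITS RESIDUAL ORBIT», LINEARLY** — the reducible-stratum
edition of ✓(T7b) §4 `exists_residual_near_of_near_orbit_of_irr`, SAME constant.  Let `U₀, U` lie over the same datum `V`, let `K_V` be a near-STABILISER-rigidity constant of `V`
(`HR`: every `s` is sitewise within `K_V·d(s•V,V)` of an exact symmetry of `V` — ✓`exists_near_stabiliser`, zero hypotheses), let every symmetry of `V` lift to a symmetry of `U₀`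
(`hlift`, pen 4's token at `U₀`), let the descent be Lipschitz at `U₀` in sup-norm on the ball `‖U₀ − B‖_∞ ≤ ρ₀` with constant `Kπ` ((Lπ)_loc), and let a FINE `u` have
`Σ_ℓ dist1 (U ℓ·((u•U₀) ℓ)⁻¹)² ≤ ρ²`, `0 ≤ ρ ≤ ρ₀`.  Then some RESIDUAL `w` has `(Σ_ℓ dist1 ((w•U) ℓ·(U₀ ℓ)⁻¹)²)^{1/2} ≤ (1 + 2·√#bonds_K·K_V·√#bonds_J·Kπ)·ρ`.  Mechanism: as (T7b) —
`(u⁻¹)↓` moves `V` by `≤ Kπ·ρ` per bond, so it is sitewise within `η := K_V·√#bonds_J·Kπ·ρ` of a symmetry `k₀` of `V`; `k₀` lifts to `k̃` with `k̃ • U₀ = U₀`, so `u₁ := u·k̃` has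
`u₁ • U₀ = u • U₀` and `(u₁⁻¹)↓ = k₀⁻¹·(u⁻¹)↓` is sitewise within `η` of `1`; then (T7a) §3's residual correction of `u₁⁻¹`.
[cite: Balaban1985Variational, (4) p.278, Thm 1 (8)-(10) p.279; Balaban1985Averaging, (8) p.19, (11)-(13) p.19, Prop. 5 (157) p.42; Balaban1985RegularSpaces, Thm 2 p.83] -/
theorem exists_residual_near_of_near_orbit_of_lift
    (V : GaugeField (F.P J) 0 (Matrix.specialUnitaryGroup (Fin 2) ℂ)) (U₀ U : GaugeField (F.P K) 0 (Matrix.specialUnitaryGroup (Fin 2) ℂ))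
    (hU₀V : descendTo F ℰp J K hJK U₀ = V) (hUV : descendTo F ℰp J K hJK U = V) {KV : ℝ} (hKV : 0 ≤ KV)
    (HR : ∀ s : GaugeTransf (F.P J) 0 (Matrix.specialUnitaryGroup (Fin 2) ℂ),
      ∃ k : GaugeTransf (F.P J) 0 (Matrix.specialUnitaryGroup (Fin 2) ℂ), GaugeField.gaugeAct k V = V ∧
        ∀ y, ‖(s y : Matrix (Fin 2) (Fin 2) ℂ) - (k y : Matrix (Fin 2) (Fin 2) ℂ)‖ ≤
          KV * Real.sqrt (∑ b : PBond (F.P J) 0, dist1 ((GaugeField.gaugeAct s V) b * (V b)⁻¹) ^ 2))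
    (hlift : ∀ s : GaugeTransf (F.P J) 0 (Matrix.specialUnitaryGroup (Fin 2) ℂ), GaugeField.gaugeAct s V = V →
      ∃ k : GaugeTransf (F.P K) 0 (Matrix.specialUnitaryGroup (Fin 2) ℂ), GaugeField.gaugeAct k U₀ = U₀ ∧ descTransf F J K hJK k = s)
    {ρ₀ Kπ : ℝ} (hKπ : 0 ≤ Kπ)
    (hLip : ∀ (B : GaugeField (F.P K) 0 (Matrix.specialUnitaryGroup (Fin 2) ℂ)) (ρ : ℝ), 0 ≤ ρ → ρ ≤ ρ₀ →
      (∀ ℓ : PBond (F.P K) 0, ‖(U₀ ℓ : Matrix (Fin 2) (Fin 2) ℂ) - (B ℓ : Matrix (Fin 2) (Fin 2) ℂ)‖ ≤ ρ) →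
      ∀ b : PBond (F.P J) 0,
        ‖((descendTo F ℰp J K hJK U₀ b : Matrix.specialUnitaryGroup (Fin 2) ℂ) : Matrix (Fin 2) (Fin 2) ℂ) - ((descendTo F ℰp J K hJK B b : Matrix.specialUnitaryGroup (Fin 2) ℂ) : Matrix (Fin 2) (Fin 2) ℂ)‖ ≤ Kπ * ρ)
    (u : Site (F.P K) 0 → Matrix.specialUnitaryGroup (Fin 2) ℂ) {ρ : ℝ} (hρ0 : 0 ≤ ρ) (hρρ₀ : ρ ≤ ρ₀)
    (hρ : ∑ ℓ : PBond (F.P K) 0, dist1 (U ℓ * ((GaugeField.gaugeAct u U₀) ℓ)⁻¹) ^ 2 ≤ ρ ^ 2) :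
    ∃ w : Site (F.P K) 0 → Matrix.specialUnitaryGroup (Fin 2) ℂ,
      (∀ U'' : GaugeField (F.P K) 0 (Matrix.specialUnitaryGroup (Fin 2) ℂ), descendTo F ℰp J K hJK (GaugeField.gaugeAct w U'') = descendTo F ℰp J K hJK U'') ∧
        Real.sqrt (∑ ℓ : PBond (F.P K) 0, dist1 ((GaugeField.gaugeAct w U) ℓ * (U₀ ℓ)⁻¹) ^ 2) ≤
          (1 + 2 * Real.sqrt (Fintype.card (PBond (F.P K) 0) : ℝ) * (KV * (Real.sqrt (Fintype.card (PBond (F.P J) 0) : ℝ) * Kπ))) * ρ := by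
  obtain ⟨nK, hnK⟩ : ∃ nK : ℝ, nK = (Fintype.card (PBond (F.P K) 0) : ℝ) := ⟨_, rfl⟩
  obtain ⟨nJ, hnJ⟩ : ∃ nJ : ℝ, nJ = (Fintype.card (PBond (F.P J) 0) : ℝ) := ⟨_, rfl⟩
  have hnK0 : 0 ≤ nK := by rw [hnK]; exact Nat.cast_nonneg _
  have hnJ0 : 0 ≤ nJ := by rw [hnJ]; exact Nat.cast_nonneg _
  rw [← hnK, ← hnJ]
  -- the comparison configuration `B := u⁻¹ • U`, sup-close to `U₀`
  obtain ⟨ũ, hũ⟩ : ∃ ũ : Site (F.P K) 0 → Matrix.specialUnitaryGroup (Fin 2) ℂ, ũ = fun x => (u x)⁻¹ := ⟨_, rfl⟩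
  obtain ⟨B, hB⟩ : ∃ B : GaugeField (F.P K) 0 (Matrix.specialUnitaryGroup (Fin 2) ℂ), B = GaugeField.gaugeAct ũ U := ⟨_, rfl⟩
  have huB : GaugeField.gaugeAct u B = U := by
    rw [hB, hũ]; exact gaugeAct_gaugeAct_inv (u : Site (F.P K) 0 → Matrix.specialUnitaryGroup (Fin 2) ℂ) U
  have hdB : ∑ ℓ : PBond (F.P K) 0, dist1 (U₀ ℓ * (B ℓ)⁻¹) ^ 2 ≤ ρ ^ 2 := by
    rw [← sum_dist1_sq_gaugeAct u U₀ B, huB, sum_dist1_sq_comm]; exact hρ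
  have hsupB : ∀ ℓ : PBond (F.P K) 0, ‖(U₀ ℓ : Matrix (Fin 2) (Fin 2) ℂ) - (B ℓ : Matrix (Fin 2) (Fin 2) ℂ)‖ ≤ ρ := by
    intro ℓ
    rw [← dist1_mul_inv_eq_norm_sub]
    refine (Real.le_sqrt_of_sq_le ?_).trans (le_of_eq (Real.sqrt_sq hρ0))
    exact (Finset.single_le_sum (f := fun ℓ => dist1 (U₀ ℓ * (B ℓ)⁻¹) ^ 2) (fun ℓ _ => sq_nonneg _) (Finset.mem_univ ℓ)).trans hdB
  -- (Lπ)_loc at the pair `(U₀, B)`: the descended datum moves by at most `Kπ·ρ` per bond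
  obtain ⟨s, hsdef⟩ : ∃ s : Site (F.P J) 0 → Matrix.specialUnitaryGroup (Fin 2) ℂ, s = descTransf F J K hJK ũ := ⟨_, rfl⟩
  have hdescB : descendTo F ℰp J K hJK B = GaugeField.gaugeAct s V := by
    rw [hB, descendTo_gaugeAct, hUV, hsdef]
  have hLipB := hLip B ρ hρ0 hρρ₀ hsupB
  have hdJ : ∑ b : PBond (F.P J) 0, dist1 ((GaugeField.gaugeAct s V) b * (V b)⁻¹) ^ 2 ≤ nJ * (Kπ * ρ) ^ 2 := by
    have hterm : ∀ b : PBond (F.P J) 0, dist1 ((GaugeField.gaugeAct s V) b * (V b)⁻¹) ^ 2 ≤ (Kπ * ρ) ^ 2 := by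
      intro b
      refine pow_le_pow_left₀ (GaugeGroup.dist1_nonneg _) ?_ 2
      have h1 := hLipB b
      rw [hU₀V, hdescB, ← dist1_mul_inv_eq_norm_sub] at h1
      rwa [B11GaugeGlue.dist1_mul_inv_comm] at h1
    calc ∑ b : PBond (F.P J) 0, dist1 ((GaugeField.gaugeAct s V) b * (V b)⁻¹) ^ 2
        ≤ ∑ _b : PBond (F.P J) 0, (Kπ * ρ) ^ 2 := Finset.sum_le_sum fun b _ => hterm b
      _ = nJ * (Kπ * ρ) ^ 2 := by rw [Finset.sum_const, Finset.card_univ, nsmul_eq_mul, hnJ]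
  -- NEAR-STABILISER RIGIDITY: `s` is sitewise near an EXACT symmetry `k₀` of `V`
  obtain ⟨k₀, hk₀V, hk₀⟩ := HR s
  obtain ⟨η, hη⟩ : ∃ η : ℝ, η = KV * (Real.sqrt nJ * Kπ) * ρ := ⟨_, rfl⟩
  have hη0 : 0 ≤ η := by rw [hη]; positivity
  have hsk₀ : ∀ y, ‖(s y : Matrix (Fin 2) (Fin 2) ℂ) - (k₀ y : Matrix (Fin 2) (Fin 2) ℂ)‖ ≤ η := by
    intro y
    refine (hk₀ y).trans ?_
    have h1 : Real.sqrt (∑ b : PBond (F.P J) 0, dist1 ((GaugeField.gaugeAct s V) b * (V b)⁻¹) ^ 2) ≤ Real.sqrt nJ * Kπ * ρ := by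
      refine (Real.sqrt_le_sqrt hdJ).trans (le_of_eq ?_)
      rw [Real.sqrt_mul hnJ0, Real.sqrt_sq (by positivity), mul_assoc]
    calc KV * Real.sqrt (∑ b : PBond (F.P J) 0, dist1 ((GaugeField.gaugeAct s V) b * (V b)⁻¹) ^ 2)
        ≤ KV * (Real.sqrt nJ * Kπ * ρ) := mul_le_mul_of_nonneg_left h1 hKV
      _ = η := by rw [hη]; ring
  -- THE LIFT: `k₀` lifts to a symmetry `kL` of `U₀`; the corrected fine transformation `u₁ := u·kL`
  obtain ⟨kL, hkLU₀, hkLs⟩ := hlift k₀ hk₀V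
  obtain ⟨u₁, hu₁⟩ : ∃ u₁ : Site (F.P K) 0 → Matrix.specialUnitaryGroup (Fin 2) ℂ, u₁ = fun x => u x * kL x := ⟨_, rfl⟩
  have hu₁U₀ : GaugeField.gaugeAct u₁ U₀ = GaugeField.gaugeAct u U₀ := by
    have h1 := gaugeAct_mul_eq (u : Site (F.P K) 0 → Matrix.specialUnitaryGroup (Fin 2) ℂ) (kL : Site (F.P K) 0 → Matrix.specialUnitaryGroup (Fin 2) ℂ) U₀
    rw [hkLU₀] at h1
    rw [hu₁]; exact h1
  obtain ⟨ũ₁, hũ₁⟩ : ∃ ũ₁ : Site (F.P K) 0 → Matrix.specialUnitaryGroup (Fin 2) ℂ, ũ₁ = fun x => (u₁ x)⁻¹ := ⟨_, rfl⟩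
  have hũ₁' : ũ₁ = fun x => (kL x)⁻¹ * (u x)⁻¹ := by
    rw [hũ₁, hu₁]; funext x; exact mul_inv_rev _ _
  have hũ₁U₀ : GaugeField.gaugeAct ũ₁ (GaugeField.gaugeAct u U₀) = U₀ := by
    rw [← hu₁U₀, hũ₁]; exact gaugeAct_inv_gaugeAct (u₁ : Site (F.P K) 0 → Matrix.specialUnitaryGroup (Fin 2) ℂ) U₀
  obtain ⟨s₁, hs₁def⟩ : ∃ s₁ : Site (F.P J) 0 → Matrix.specialUnitaryGroup (Fin 2) ℂ, s₁ = descTransf F J K hJK ũ₁ := ⟨_, rfl⟩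
  -- `s₁ = k₀⁻¹·s` sitewise, hence sitewise within `η` of `1`
  have hs₁y : ∀ y, s₁ y = (k₀ y)⁻¹ * s y := by
    intro y
    have h1 : descTransf F J K hJK ũ₁ y = (descTransf F J K hJK kL y)⁻¹ * (descTransf F J K hJK u y)⁻¹ := by
      rw [hũ₁']; exact transfUp_inv_mul_inv F kL u _ _
    have h2 : s y = (descTransf F J K hJK u y)⁻¹ := by
      rw [hsdef, hũ]; exact transfUp_inv' F u _ _
    rw [hs₁def, h1, hkLs, h2]
  have hsη : ∀ y, ‖(s₁ y : Matrix (Fin 2) (Fin 2) ℂ) - (1 : ℂ) • 1‖ ≤ η := by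
    intro y
    have hkU : (((k₀ y)⁻¹ : Matrix.specialUnitaryGroup (Fin 2) ℂ) : Matrix (Fin 2) (Fin 2) ℂ) ∈ unitary (Matrix (Fin 2) (Fin 2) ℂ) := ((k₀ y)⁻¹).2.1
    have h1 : (s₁ y : Matrix (Fin 2) (Fin 2) ℂ) - (1 : ℂ) • 1 =
        (((k₀ y)⁻¹ : Matrix.specialUnitaryGroup (Fin 2) ℂ) : Matrix (Fin 2) (Fin 2) ℂ) * ((s y : Matrix (Fin 2) (Fin 2) ℂ) - (k₀ y : Matrix (Fin 2) (Fin 2) ℂ)) := by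
      have hkk : (((k₀ y)⁻¹ : Matrix.specialUnitaryGroup (Fin 2) ℂ) : Matrix (Fin 2) (Fin 2) ℂ) * (k₀ y : Matrix (Fin 2) (Fin 2) ℂ) = 1 := by
        rw [← Submonoid.coe_mul, inv_mul_cancel, OneMemClass.coe_one]
      rw [one_smul, hs₁y, Submonoid.coe_mul, mul_sub, hkk]
    rw [h1, CStarRing.norm_mem_unitary_mul _ hkU]
    exact hsk₀ y
  -- (T7a) §3: the block-constant lift `k` of `s₁` and the residual `w := ũ₁·k⁻¹`
  obtain ⟨k, hk⟩ : ∃ k : Site (F.P K) 0 → Matrix.specialUnitaryGroup (Fin 2) ℂ, k = liftTransfTo F J K hJK s₁ := ⟨_, rfl⟩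
  have hkη : ∀ z, ‖(k z : Matrix (Fin 2) (Fin 2) ℂ) - (1 : ℂ) • 1‖ ≤ η := fun z => by rw [hk]; exact norm_liftTransfTo_sub_smul_one_le F hJK s₁ 1 hsη z
  obtain ⟨w, hw⟩ : ∃ w : Site (F.P K) 0 → Matrix.specialUnitaryGroup (Fin 2) ℂ, w = fun x => ũ₁ x * (k x)⁻¹ := ⟨_, rfl⟩
  have hwres : ∀ U'' : GaugeField (F.P K) 0 (Matrix.specialUnitaryGroup (Fin 2) ℂ),
      descendTo F ℰp J K hJK (GaugeField.gaugeAct w U'') = descendTo F ℰp J K hJK U'' := by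
    rw [hw, hk, hs₁def]; exact residual_mul_inv_liftTransfTo F hJK ũ₁
  refine ⟨w, hwres, ?_⟩
  -- `w • U = ũ₁ • (k⁻¹ • U)` and its distance to `U₀`
  have hwU : GaugeField.gaugeAct w U = GaugeField.gaugeAct ũ₁ (GaugeField.gaugeAct (k⁻¹ : Site (F.P K) 0 → Matrix.specialUnitaryGroup (Fin 2) ℂ) U) := by
    rw [← gaugeAct_mul_eq, hw]; rfl
  obtain ⟨S1, hS1⟩ : ∃ S1 : ℝ, S1 = ∑ ℓ : PBond (F.P K) 0,
      dist1 ((GaugeField.gaugeAct ũ₁ (GaugeField.gaugeAct (k⁻¹ : Site (F.P K) 0 → Matrix.specialUnitaryGroup (Fin 2) ℂ) U)) ℓ * ((GaugeField.gaugeAct ũ₁ U) ℓ)⁻¹) ^ 2 := ⟨_, rfl⟩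
  have hk1 : S1 ≤ 4 * nK * η ^ 2 := by
    rw [hS1, sum_dist1_sq_gaugeAct ũ₁]
    have h1 := sum_dist1_sq_gaugeAct_le_of_near_scalar k 1 hkη (GaugeField.gaugeAct (k⁻¹ : Site (F.P K) 0 → Matrix.specialUnitaryGroup (Fin 2) ℂ) U)
    rw [gaugeAct_gaugeAct_inv] at h1
    rwa [sum_dist1_sq_comm, hnK]
  obtain ⟨S2, hS2⟩ : ∃ S2 : ℝ, S2 = ∑ ℓ : PBond (F.P K) 0, dist1 ((GaugeField.gaugeAct ũ₁ U) ℓ * (U₀ ℓ)⁻¹) ^ 2 := ⟨_, rfl⟩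
  have hk2 : S2 ≤ ρ ^ 2 := by
    rw [hS2]
    conv_lhs => rw [← hũ₁U₀]
    rw [sum_dist1_sq_gaugeAct ũ₁ U (GaugeField.gaugeAct u U₀)]
    exact hρ
  have htri : Real.sqrt (∑ ℓ : PBond (F.P K) 0, dist1 ((GaugeField.gaugeAct w U) ℓ * (U₀ ℓ)⁻¹) ^ 2) ≤ Real.sqrt S1 + Real.sqrt S2 := by
    have h := sqrt_sum_dist1_sq_triangle (GaugeField.gaugeAct ũ₁ (GaugeField.gaugeAct (k⁻¹ : Site (F.P K) 0 → Matrix.specialUnitaryGroup (Fin 2) ℂ) U)) (GaugeField.gaugeAct ũ₁ U) U₀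
    rw [← hS1, ← hS2, ← hwU] at h
    exact h
  have hsq1 : Real.sqrt S1 ≤ 2 * Real.sqrt nK * η := by
    refine (Real.sqrt_le_sqrt hk1).trans (le_of_eq ?_)
    rw [show (4 : ℝ) * nK * η ^ 2 = (2 * Real.sqrt nK * η) ^ 2 by rw [mul_pow, mul_pow, Real.sq_sqrt hnK0]; ring]
    exact Real.sqrt_sq (by positivity)
  have hsq2 : Real.sqrt S2 ≤ ρ := (Real.sqrt_le_sqrt hk2).trans (le_of_eq (Real.sqrt_sq hρ0))
  calc Real.sqrt (∑ ℓ : PBond (F.P K) 0, dist1 ((GaugeField.gaugeAct w U) ℓ * (U₀ ℓ)⁻¹) ^ 2)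
      ≤ Real.sqrt S1 + Real.sqrt S2 := htri
    _ ≤ 2 * Real.sqrt nK * η + ρ := add_le_add hsq1 hsq2
    _ = (1 + 2 * Real.sqrt nK * (KV * (Real.sqrt nJ * Kπ))) * ρ := by rw [hη]; ring

end Lift

/-! ## §2 The central-stabiliser datum is a special case: there `hlift` holds at every base point -/

section Central

variable (F : T3Family) {J K : ℕ} (hJK : J ≤ K)

/-- Restriction up the centres of a constant transformation is the constant. [cite: Balaban1985Averaging, (12)-(13) p.19] -/
theorem transfUp_const (c : Matrix.specialUnitaryGroup (Fin 2) ℂ) :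
    ∀ (i : ℕ) (y : Site (F.P K) i), transfUp (fun _ : Site (F.P K) 0 => c) i y = c
  | 0, _ => rfl
  | i + 1, _ => transfUp_const c i _

/-- **AT A CENTRAL-STABILISER DATUM EVERY SYMMETRY LIFTS TO EVERY BASE POINT**: if every `s` with `s • V = V` is `1` or `−1` (✓pen 4's token, cited), then pen 4's lifting hypothesis
`hlift` holds at EVERY fine `U₀` (lift `±1` to the constant `±1`, which is central and fixes every field) — so ✓(T7b) is the special case of (T7-red, II) at irreducible data.
[cite: Balaban1985Variational, (4) p.278, Prop. 7 p.299; Balaban1985Averaging, (8) p.19, (12)-(13) p.19] -/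
theorem symmetriesLift_of_centralStab (V : GaugeField (F.P J) 0 (Matrix.specialUnitaryGroup (Fin 2) ℂ))
    (hstab : ∀ s : GaugeTransf (F.P J) 0 (Matrix.specialUnitaryGroup (Fin 2) ℂ), GaugeField.gaugeAct s V = V →
      s = (fun _ => 1) ∨ s = (fun _ => (⟨-1, neg_one_mem⟩ : Matrix.specialUnitaryGroup (Fin 2) ℂ)))
    (U₀ : GaugeField (F.P K) 0 (Matrix.specialUnitaryGroup (Fin 2) ℂ)) :
    ∀ s : GaugeTransf (F.P J) 0 (Matrix.specialUnitaryGroup (Fin 2) ℂ), GaugeField.gaugeAct s V = V →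
      ∃ k : GaugeTransf (F.P K) 0 (Matrix.specialUnitaryGroup (Fin 2) ℂ), GaugeField.gaugeAct k U₀ = U₀ ∧ descTransf F J K hJK k = s := by
  intro s hs
  rcases hstab s hs with h1 | hm1
  · refine ⟨fun _ => 1, ?_, ?_⟩
    · funext b; simp [GaugeField.gaugeAct]
    · rw [h1]; funext y; exact transfUp_const F 1 _ _
  · refine ⟨fun _ => (⟨-1, neg_one_mem⟩ : Matrix.specialUnitaryGroup (Fin 2) ℂ), ?_, ?_⟩
    · exact gaugeAct_const_of_comm (fun g => Subtype.ext (by simp)) U₀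
    · rw [hm1]; funext y; exact transfUp_const F _ _ _

end Central

end Summit.QuantumFields.YangMills.Theorems.FluctuationComparisonRegPrIntLS2BetaResidualNearOfStabiliserLift

end
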